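import Summits.NavierStokesRegularity.NavierStokesRegularity.Theorems.PerpetualPumpAveragedTypeIBlowupChainContinuationTools
import Literature.Analysis.FluidPDE.TaoCascadeODE
import Mathlib
import HarnessLib

/-!
# `PerpetualPump.PumpTransfer` (stmt-NavierStokesRegularity-1837), line `Sketch`: stub `majorantOfEnvelope`

The transfer of the STAIRCASE CERTIFICATE from the coefficients `Y` of a chain solution to Tao's band
majorants (`stub_majorantOfEnvelope` of the lead's skeleton `Cruxes/PumpTransfer/Lines/Sketch.lean`, v3, lead
prover prover-line-stmt-NavierStokesRegularity-1837-c1; statement registered verbatim).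

Tao's band majorant of mode `(i,n)` of the averaged Navier–Stokes cascade (J. Amer. Math. Soc. 29 (2016),
§4 (4.8), (4.14)) is
`b_{i,n}(t) = e^{-D_n t}|A| 1_{(i,n)=(i₀,n₀)} + ∫₀ᵗ |quadTerm(Y)_{i,n}(s)| e^{-D_n (t-s)} ds`, `D_n = 4π²(1+ε₀)^{2n}`,
where `quadTerm` (`Literature/Analysis/FluidPDE/TaoCascadeODE.lean`) is the circuit nonlinearity
`∑_{i₁,i₂} ∑_{μ ∈ S} α_{i₁i₂iμ} (1+ε₀)^{5(n-μ₃)/2} Y_{i₁,n-μ₃+μ₁} Y_{i₂,n-μ₃+μ₂}` over the shift set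
`S = {(0,0,0),(1,0,0),(0,1,0),(0,0,1)}`; the monomials of `quadTerm_{i,n}` live at the scale pairs
`(n,n), (n+1,n), (n,n+1), (n-1,n-1)`.

* (B0) below the datum scale (`n < n₀`, where `Y ≡ 0`) every monomial has a factor at scale `n` or `n-1`,
  so `quadTerm_{i,n} ≡ 0` and `b_{i,n} ≡ 0` (`quadTerm_eq_zero_of_lt` of crux #3's landed
  `Theorems/PerpetualPumpAveragedTypeIBlowupChainContinuationTools.lean`, imported; also `coeffSum_le`,
  `shiftSet_mem_bounds` from there).
* (B1)/(B2) `pumpMajorant_abs_quadTerm_le`: if every coefficient at scale `n' ≥ n-1` obeys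
  `|Y_{j,n'}(s)| ≤ K (1+ε₀)^{-n'/2} L` then `|quadTerm_{i,n}(s)| ≤ C_α(i) (KL)² (1+ε₀)^{3n/2}`
  (`C_α(i) = ∑_{i₁,i₂,μ} |α_{i₁i₂iμ}|`; exponent bookkeeping
  `5(n-μ₃)/2 - (n-μ₃+μ₁)/2 - (n-μ₃+μ₂)/2 = (3(n-μ₃)-μ₁-μ₂)/2 ≤ 3n/2`);
  `pumpMajorant_duhamel_le`: `∫₀ᵗ f e^{-D(t-s)} ds ≤ B/D` for `0 ≤ f ≤ B` on `[0,t]`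
  (`∫₀ᵗ e^{-D(t-s)} ds = (1-e^{-Dt})/D`, `pumpMajorant_integral_exp`); together
  (`pumpMajorant_integral_quadTerm_le`) the Duhamel integral is `≤ (C_α K²/(4π²)) (1+ε₀)^{-n/2} L` for
  `0 ≤ L ≤ 1`: the damping `D_n = 4π²(1+ε₀)^{2n}` turns `(1+ε₀)^{3n/2}` into `(1+ε₀)^{-n/2}`.
  The critical envelope is `L = 1`; above the front (`t < T_{k+1}`, `n ≥ n₀+k+3`) both factors of every
  monomial sit at scales `≥ n-1 ≥ n₀+k+2`, where the tail hypothesis gives the extra factor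
  `(2(1+ε₀))^{n₀+k+1-n'} ≤ (2(1+ε₀))^{n₀+k+2-n} = L ≤ 1`.
The constant is `K' = K + C_α K²/(4π²)`, `C_α = ∑_i C_α(i)`.

Design note: the integral bound `pumpMajorant_duhamel_le` is proved with `MeasureTheory.integral_mono_of_nonneg`,
so no integrability of `s ↦ |quadTerm_{i,n}(Y)(s)|` is needed (a non-integrable integrand has Bochner integral
`0 ≤ B/D`); in particular the continuity hypothesis of the registered statement is not used.

References: T. Tao, J. Amer. Math. Soc. 29 (2016), 601–674 = arXiv:1402.0290v3, §4 (4.8), p. 22 (4.14).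
[`Tao2016AveragedNS`]
-/

noncomputable section

-- the nested summit namespace is the tree's layout (D-0017)
set_option linter.dupNamespace false

namespace Summit.NavierStokesRegularity.NavierStokesRegularity.Theorems.PerpetualPumpPumpTransfer

open MeasureTheory Set Filter Topology
open scoped ENNReal
open Literature.Analysis.FluidPDE
open Literature.Analysis.FluidPDE.TaoCascade (quadTerm shiftSet)
open Summit.NavierStokesRegularity.NavierStokesRegularity.Theorems.PerpetualPumpAveragedTypeIBlowup

variable {ε₀ : ℝ} {m : ℕ}

/-- **Pointwise size of the forcing under a scale envelope.** If every coefficient at scale `n' ≥ n - 1`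
obeys `|Y_{j,n'}(s)| ≤ K (1+ε₀)^{-n'/2} L` (`ε₀ ≥ 0`), then
`|quadTerm_{i,n}(Y)(s)| ≤ (∑_{i₁,i₂,μ} |α_{i₁i₂iμ}|) (KL)² (1+ε₀)^{3n/2}`: a monomial with shift `μ ∈ S` is
bounded by `|α| (KL)² (1+ε₀)^{(3(n-μ₃)-μ₁-μ₂)/2}` and `μ₁, μ₂, μ₃ ∈ {0,1}`. [cite: Tao2016AveragedNS, §4 (4.8)] -/
theorem pumpMajorant_abs_quadTerm_le (hε : 0 ≤ ε₀) (α : Fin m → Fin m → Fin m → ℤ × ℤ × ℤ → ℝ)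
    (Y : Fin m → ℤ → ℝ → ℝ) {K L : ℝ} (i : Fin m) (n : ℤ) (s : ℝ)
    (hY : ∀ (j : Fin m) (n' : ℤ), n - 1 ≤ n' → |Y j n' s| ≤ K * (1 + ε₀) ^ (-(n' : ℝ) / 2) * L) :
    |quadTerm ε₀ α Y i n s| ≤
      (∑ i₁ : Fin m, ∑ i₂ : Fin m, ∑ μ ∈ shiftSet, |α i₁ i₂ i μ|) *
        ((K * L) ^ 2 * (1 + ε₀) ^ ((3 : ℝ) * n / 2)) := by
  have ha0 : 0 < 1 + ε₀ := by linarith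
  have ha1 : 1 ≤ 1 + ε₀ := by linarith
  have hterm : ∀ (i₁ i₂ : Fin m), ∀ μ ∈ shiftSet,
      |α i₁ i₂ i μ * (1 + ε₀) ^ ((5 : ℝ) * ((n : ℝ) - (μ.2.2 : ℝ)) / 2) *
          (Y i₁ (n - μ.2.2 + μ.1) s * Y i₂ (n - μ.2.2 + μ.2.1) s)| ≤
        |α i₁ i₂ i μ| * ((K * L) ^ 2 * (1 + ε₀) ^ ((3 : ℝ) * n / 2)) := by
    intro i₁ i₂ μ hμ
    obtain ⟨h1, h2, h3, h3', -⟩ := shiftSet_mem_bounds hμ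
    have hYa := hY i₁ (n - μ.2.2 + μ.1) (by omega)
    have hYb := hY i₂ (n - μ.2.2 + μ.2.1) (by omega)
    have key : (1 + ε₀) ^ ((5 : ℝ) * ((n : ℝ) - (μ.2.2 : ℝ)) / 2) *
        ((1 + ε₀) ^ (-((n - μ.2.2 + μ.1 : ℤ) : ℝ) / 2) *
          (1 + ε₀) ^ (-((n - μ.2.2 + μ.2.1 : ℤ) : ℝ) / 2)) ≤
        (1 + ε₀) ^ ((3 : ℝ) * n / 2) := by
      rw [← Real.rpow_add ha0, ← Real.rpow_add ha0]
      refine Real.rpow_le_rpow_of_exponent_le ha1 ?_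
      have h1r : (0 : ℝ) ≤ μ.1 := by exact_mod_cast h1
      have h2r : (0 : ℝ) ≤ μ.2.1 := by exact_mod_cast h2
      have h3r : (0 : ℝ) ≤ μ.2.2 := by exact_mod_cast h3
      push_cast
      linarith
    rw [abs_mul, abs_mul, abs_mul, abs_of_pos (Real.rpow_pos_of_pos ha0 _), mul_assoc]
    refine mul_le_mul_of_nonneg_left ?_ (abs_nonneg _)
    calc (1 + ε₀) ^ ((5 : ℝ) * ((n : ℝ) - (μ.2.2 : ℝ)) / 2) *
          (|Y i₁ (n - μ.2.2 + μ.1) s| * |Y i₂ (n - μ.2.2 + μ.2.1) s|)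
        ≤ (1 + ε₀) ^ ((5 : ℝ) * ((n : ℝ) - (μ.2.2 : ℝ)) / 2) *
            ((K * (1 + ε₀) ^ (-((n - μ.2.2 + μ.1 : ℤ) : ℝ) / 2) * L) *
              (K * (1 + ε₀) ^ (-((n - μ.2.2 + μ.2.1 : ℤ) : ℝ) / 2) * L)) :=
          mul_le_mul_of_nonneg_left (mul_le_mul hYa hYb (abs_nonneg _) ((abs_nonneg _).trans hYa))
            (Real.rpow_nonneg ha0.le _)
      _ = (K * L) ^ 2 * ((1 + ε₀) ^ ((5 : ℝ) * ((n : ℝ) - (μ.2.2 : ℝ)) / 2) *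
            ((1 + ε₀) ^ (-((n - μ.2.2 + μ.1 : ℤ) : ℝ) / 2) *
              (1 + ε₀) ^ (-((n - μ.2.2 + μ.2.1 : ℤ) : ℝ) / 2))) := by ring
      _ ≤ (K * L) ^ 2 * (1 + ε₀) ^ ((3 : ℝ) * n / 2) := mul_le_mul_of_nonneg_left key (sq_nonneg _)
  unfold quadTerm
  calc |∑ i₁ : Fin m, ∑ i₂ : Fin m, ∑ μ ∈ shiftSet,
          α i₁ i₂ i μ * (1 + ε₀) ^ ((5 : ℝ) * ((n : ℝ) - (μ.2.2 : ℝ)) / 2) *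
            (Y i₁ (n - μ.2.2 + μ.1) s * Y i₂ (n - μ.2.2 + μ.2.1) s)|
      ≤ ∑ i₁ : Fin m, ∑ i₂ : Fin m, ∑ μ ∈ shiftSet,
          |α i₁ i₂ i μ * (1 + ε₀) ^ ((5 : ℝ) * ((n : ℝ) - (μ.2.2 : ℝ)) / 2) *
            (Y i₁ (n - μ.2.2 + μ.1) s * Y i₂ (n - μ.2.2 + μ.2.1) s)| := by
        refine (Finset.abs_sum_le_sum_abs _ _).trans (Finset.sum_le_sum fun i₁ _ => ?_)
        refine (Finset.abs_sum_le_sum_abs _ _).trans (Finset.sum_le_sum fun i₂ _ => ?_)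
        exact Finset.abs_sum_le_sum_abs _ _
    _ ≤ ∑ i₁ : Fin m, ∑ i₂ : Fin m, ∑ μ ∈ shiftSet,
          |α i₁ i₂ i μ| * ((K * L) ^ 2 * (1 + ε₀) ^ ((3 : ℝ) * n / 2)) :=
        Finset.sum_le_sum fun i₁ _ => Finset.sum_le_sum fun i₂ _ =>
          Finset.sum_le_sum fun μ hμ => hterm i₁ i₂ μ hμ
    _ = (∑ i₁ : Fin m, ∑ i₂ : Fin m, ∑ μ ∈ shiftSet, |α i₁ i₂ i μ|) *
          ((K * L) ^ 2 * (1 + ε₀) ^ ((3 : ℝ) * n / 2)) := by simp only [Finset.sum_mul]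

/-- `∫₀ᵗ e^{-D(t-s)} ds = (1 - e^{-Dt})/D` for `D ≠ 0` (the antiderivative is `e^{-D(t-s)}/D`). [folklore] -/
theorem pumpMajorant_integral_exp {D : ℝ} (hD : D ≠ 0) (t : ℝ) :
    ∫ s in (0 : ℝ)..t, Real.exp (-(D * (t - s))) = (1 - Real.exp (-(D * t))) / D := by
  have hderiv : ∀ s ∈ uIcc 0 t,
      HasDerivAt (fun s => Real.exp (-(D * (t - s))) / D) (Real.exp (-(D * (t - s)))) s := by
    intro s _
    have h1 : HasDerivAt (fun s => -(D * (t - s))) D s := by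
      simpa using (((hasDerivAt_id' s).const_sub t).const_mul D).fun_neg
    have h2 := h1.exp.div_const D
    rwa [mul_div_cancel_right₀ _ hD] at h2
  rw [intervalIntegral.integral_eq_sub_of_hasDerivAt hderiv
    ((by fun_prop : Continuous fun s => Real.exp (-(D * (t - s)))).intervalIntegrable _ _)]
  simp only [sub_self, mul_zero, neg_zero, Real.exp_zero, sub_zero]
  ring

/-- **Time integration against the damping.** If `0 ≤ f ≤ B` on `[0,t]` (`t ≥ 0`, `D > 0`) then
`∫₀ᵗ f(s) e^{-D(t-s)} ds ≤ B/D`, because `∫₀ᵗ e^{-D(t-s)} ds = (1 - e^{-Dt})/D ≤ 1/D`. No integrability of `f`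
is assumed (a non-integrable integrand has Bochner integral `0`). [folklore] -/
theorem pumpMajorant_duhamel_le {f : ℝ → ℝ} {D B t : ℝ} (hD : 0 < D) (hB : 0 ≤ B) (ht : 0 ≤ t)
    (hf0 : ∀ s ∈ Icc 0 t, 0 ≤ f s) (hfB : ∀ s ∈ Icc 0 t, f s ≤ B) :
    ∫ s in (0 : ℝ)..t, f s * Real.exp (-(D * (t - s))) ≤ B / D := by
  have hg : Continuous fun s => B * Real.exp (-(D * (t - s))) := by fun_prop
  calc ∫ s in (0 : ℝ)..t, f s * Real.exp (-(D * (t - s)))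
      ≤ ∫ s in (0 : ℝ)..t, B * Real.exp (-(D * (t - s))) := by
        rw [intervalIntegral.integral_of_le ht, intervalIntegral.integral_of_le ht]
        refine integral_mono_of_nonneg ?_ (hg.integrableOn_Icc.mono_set Ioc_subset_Icc_self) ?_
        · filter_upwards [ae_restrict_mem measurableSet_Ioc] with s hs
          exact mul_nonneg (hf0 s (Ioc_subset_Icc_self hs)) (Real.exp_nonneg _)
        · filter_upwards [ae_restrict_mem measurableSet_Ioc] with s hs
          exact mul_le_mul_of_nonneg_right (hfB s (Ioc_subset_Icc_self hs)) (Real.exp_nonneg _)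
    _ = B * ((1 - Real.exp (-(D * t))) / D) := by
        rw [intervalIntegral.integral_const_mul, pumpMajorant_integral_exp hD.ne' t]
    _ ≤ B * (1 / D) := by
        refine mul_le_mul_of_nonneg_left (div_le_div_of_nonneg_right ?_ hD.le) hB
        linarith [Real.exp_nonneg (-(D * t))]
    _ = B / D := mul_one_div B D

/-- **The Duhamel integral of the band majorant under a scale envelope.** If on `[0,t]` every coefficient at
scale `n' ≥ n-1` obeys `|Y_{j,n'}(s)| ≤ K (1+ε₀)^{-n'/2} L` with `0 ≤ L ≤ 1` (`ε₀ ≥ 0`), then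
`∫₀ᵗ |quadTerm_{i,n}(Y)(s)| e^{-4π²(1+ε₀)^{2n}(t-s)} ds ≤ (C_α K²/(4π²)) (1+ε₀)^{-n/2} L`,
`C_α = ∑_{i₃,i₁,i₂,μ} |α_{i₁i₂i₃μ}|`: the pointwise bound `C_α K² L (1+ε₀)^{3n/2}` of
`pumpMajorant_abs_quadTerm_le` against the damping `4π²(1+ε₀)^{2n}` (`pumpMajorant_duhamel_le`).
[cite: Tao2016AveragedNS, §4 (4.8) and p. 22 (4.14)] -/
theorem pumpMajorant_integral_quadTerm_le (hε : 0 ≤ ε₀) (α : Fin m → Fin m → Fin m → ℤ × ℤ × ℤ → ℝ)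
    (Y : Fin m → ℤ → ℝ → ℝ) {K L t : ℝ} (hL : 0 ≤ L) (hL1 : L ≤ 1) (ht : 0 ≤ t)
    (i : Fin m) (n : ℤ)
    (hY : ∀ s ∈ Icc 0 t, ∀ (j : Fin m) (n' : ℤ), n - 1 ≤ n' →
      |Y j n' s| ≤ K * (1 + ε₀) ^ (-(n' : ℝ) / 2) * L) :
    ∫ s in (0 : ℝ)..t, |quadTerm ε₀ α Y i n s| *
        Real.exp (-(4 * Real.pi ^ 2 * (1 + ε₀) ^ (2 * n) * (t - s))) ≤
      (∑ i₃ : Fin m, ∑ i₁ : Fin m, ∑ i₂ : Fin m, ∑ μ ∈ shiftSet, |α i₁ i₂ i₃ μ|) * K ^ 2 /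
          (4 * Real.pi ^ 2) * (1 + ε₀) ^ (-(n : ℝ) / 2) * L := by
  obtain ⟨C, hC⟩ : ∃ C : ℝ,
      C = ∑ i₃ : Fin m, ∑ i₁ : Fin m, ∑ i₂ : Fin m, ∑ μ ∈ shiftSet, |α i₁ i₂ i₃ μ| := ⟨_, rfl⟩
  rw [← hC]
  have ha0 : 0 < 1 + ε₀ := by linarith
  have hCi : (∑ i₁ : Fin m, ∑ i₂ : Fin m, ∑ μ ∈ shiftSet, |α i₁ i₂ i μ|) ≤ C := hC ▸ coeffSum_le α i
  have hC0 : 0 ≤ C := le_trans (by positivity) hCi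
  have hD : 0 < 4 * Real.pi ^ 2 * (1 + ε₀) ^ (2 * n) := by positivity
  -- the pointwise bound `|quadTerm_{i,n}(s)| ≤ C K² L (1+ε₀)^{3n/2}` on `[0,t]`
  have hpt : ∀ s ∈ Icc 0 t,
      |quadTerm ε₀ α Y i n s| ≤ C * (K ^ 2 * L) * (1 + ε₀) ^ ((3 : ℝ) * n / 2) := by
    intro s hs
    refine (pumpMajorant_abs_quadTerm_le hε α Y i n s (hY s hs)).trans ?_
    have hKL : (K * L) ^ 2 ≤ K ^ 2 * L := by
      rw [mul_pow, sq L]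
      exact mul_le_mul_of_nonneg_left (mul_le_of_le_one_left hL hL1) (sq_nonneg K)
    calc (∑ i₁ : Fin m, ∑ i₂ : Fin m, ∑ μ ∈ shiftSet, |α i₁ i₂ i μ|) *
          ((K * L) ^ 2 * (1 + ε₀) ^ ((3 : ℝ) * n / 2))
        ≤ C * ((K ^ 2 * L) * (1 + ε₀) ^ ((3 : ℝ) * n / 2)) :=
          mul_le_mul hCi (mul_le_mul_of_nonneg_right hKL (Real.rpow_nonneg ha0.le _))
            (by positivity) hC0
      _ = C * (K ^ 2 * L) * (1 + ε₀) ^ ((3 : ℝ) * n / 2) := by ring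
  refine (pumpMajorant_duhamel_le hD (by positivity) ht (fun s _ => abs_nonneg _) hpt).trans
    (le_of_eq ?_)
  -- `C K² L (1+ε₀)^{3n/2} / (4π² (1+ε₀)^{2n}) = (C K²/(4π²)) (1+ε₀)^{-n/2} L`
  have h32 : (1 + ε₀) ^ ((3 : ℝ) * n / 2) = (1 + ε₀) ^ (-(n : ℝ) / 2) * (1 + ε₀) ^ (2 * n) := by
    rw [← Real.rpow_intCast (1 + ε₀) (2 * n), ← Real.rpow_add ha0]
    push_cast
    congr 1
    ring
  have hz : (1 + ε₀) ^ (2 * n) ≠ 0 := zpow_ne_zero _ ha0.ne'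
  calc C * (K ^ 2 * L) * (1 + ε₀) ^ ((3 : ℝ) * n / 2) / (4 * Real.pi ^ 2 * (1 + ε₀) ^ (2 * n))
      = C * K ^ 2 * (1 + ε₀) ^ (-(n : ℝ) / 2) * L * (1 + ε₀) ^ (2 * n) /
          (4 * Real.pi ^ 2 * (1 + ε₀) ^ (2 * n)) := by rw [h32]; ring
    _ = C * K ^ 2 * (1 + ε₀) ^ (-(n : ℝ) / 2) * L / (4 * Real.pi ^ 2) := mul_div_mul_right _ _ hz
    _ = C * K ^ 2 / (4 * Real.pi ^ 2) * (1 + ε₀) ^ (-(n : ℝ) / 2) * L := by ring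

/-- **Stub `majorantOfEnvelope` (riskless).** The staircase certificate on the coefficients `Y` passes to
Tao's band majorants `b_{i,n}(t) = e^{-4π²(1+ε₀)^{2n}t}|A|1_{(i,n)=(i₀,n₀)} + ∫₀ᵗ |quadTerm(Y)_{i,n}(s)|
e^{-4π²(1+ε₀)^{2n}(t-s)} ds`: (B0) `b_{i,n} = 0` below `n₀` (every monomial of `quadTerm_{i,n}` has a factor at
scale `≤ n`); (B1) `b_{i,n}(t) ≤ K' (1+ε₀)^{-n/2}` (`|quadTerm_{i,n}| ≤ C_α K² (1+ε₀)^{3n/2}` under the critical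
envelope, against the damping `4π²(1+ε₀)^{2n}`: `∫₀ᵗ e^{-D(t-s)} ds ≤ 1/D`); (B2) before `T_{k+1}` and for
`n ≥ n₀+k+3`, `b_{i,n}(t) ≤ K' (1+ε₀)^{-n/2} (2(1+ε₀))^{n₀+k+2-n}` (both factors of every monomial lie at scales
`≥ n-1 ≥ n₀+k+2`). Here `K' = K + C_α K²/(4π²)`, `C_α = ∑_{i₃,i₁,i₂,μ∈S} |α_{i₁i₂i₃μ}|`. (The hypotheses
`ε₀ ≤ 1` and the continuity of `Y` belong to the registered signature and are not used.)
[cite: Tao2016AveragedNS, §4 (4.8) and p. 22 (4.14)] -/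
theorem stub_majorantOfEnvelope :
    ∀ {ε₀ : ℝ}, 0 < ε₀ → ε₀ ≤ 1 → ∀ {m : ℕ} (α : Fin m → Fin m → Fin m → ℤ × ℤ × ℤ → ℝ)
      (i₀ : Fin m) (n₀ : ℤ) (A S K : ℝ) (T : ℕ → ℝ) (Y : Fin m → ℤ → ℝ → ℝ), 0 ≤ K →
      (∀ i n, ContinuousOn (Y i n) (Ico 0 S)) →
      (∀ i n t, n < n₀ → Y i n t = 0) →
      |A| ≤ K * (1 + ε₀) ^ (-(n₀ : ℝ) / 2) →
      (∀ (i : Fin m) (n : ℤ), ∀ s ∈ Ico 0 S, |Y i n s| ≤ K * (1 + ε₀) ^ (-(n : ℝ) / 2)) →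
      (∀ k : ℕ, ∀ s ∈ Ico 0 (T (k + 1)), s < S → ∀ (i : Fin m) (n : ℤ), n₀ + k + 2 ≤ n →
        |Y i n s| ≤ K * (1 + ε₀) ^ (-(n : ℝ) / 2) * (2 * (1 + ε₀)) ^ (n₀ + k + 1 - n)) →
      ∃ K' : ℝ, 0 ≤ K' ∧
        (∀ (i : Fin m) (n : ℤ) (t : ℝ), n < n₀ →
          Real.exp (-(4 * Real.pi ^ 2 * (1 + ε₀) ^ (2 * n) * t)) * (if i = i₀ ∧ n = n₀ then |A| else 0) +
            ∫ s in (0 : ℝ)..t, |quadTerm ε₀ α Y i n s| *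
              Real.exp (-(4 * Real.pi ^ 2 * (1 + ε₀) ^ (2 * n) * (t - s))) = 0) ∧
        (∀ (i : Fin m) (n : ℤ), ∀ t ∈ Ico 0 S,
          Real.exp (-(4 * Real.pi ^ 2 * (1 + ε₀) ^ (2 * n) * t)) * (if i = i₀ ∧ n = n₀ then |A| else 0) +
            ∫ s in (0 : ℝ)..t, |quadTerm ε₀ α Y i n s| *
              Real.exp (-(4 * Real.pi ^ 2 * (1 + ε₀) ^ (2 * n) * (t - s))) ≤
            K' * (1 + ε₀) ^ (-(n : ℝ) / 2)) ∧
        (∀ k : ℕ, ∀ t ∈ Ico 0 (T (k + 1)), t < S → ∀ (i : Fin m) (n : ℤ), n₀ + k + 3 ≤ n →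
          Real.exp (-(4 * Real.pi ^ 2 * (1 + ε₀) ^ (2 * n) * t)) * (if i = i₀ ∧ n = n₀ then |A| else 0) +
            ∫ s in (0 : ℝ)..t, |quadTerm ε₀ α Y i n s| *
              Real.exp (-(4 * Real.pi ^ 2 * (1 + ε₀) ^ (2 * n) * (t - s))) ≤
            K' * (1 + ε₀) ^ (-(n : ℝ) / 2) * (2 * (1 + ε₀)) ^ (n₀ + k + 2 - n)) := by
  intro ε₀ hε₀ _hε₁ m α i₀ n₀ A S K T Y hK _hcont hlow hA henv htail
  have ha0 : 0 < 1 + ε₀ := by linarith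
  have h2a : 1 ≤ 2 * (1 + ε₀) := by linarith
  obtain ⟨C, hC⟩ : ∃ C : ℝ,
      C = ∑ i₃ : Fin m, ∑ i₁ : Fin m, ∑ i₂ : Fin m, ∑ μ ∈ shiftSet, |α i₁ i₂ i₃ μ| := ⟨_, rfl⟩
  have hC0 : 0 ≤ C := by rw [hC]; positivity
  have hCK : 0 ≤ C * K ^ 2 / (4 * Real.pi ^ 2) := by positivity
  refine ⟨K + C * K ^ 2 / (4 * Real.pi ^ 2), by positivity, ?_, ?_, ?_⟩
  · -- (B0): below `n₀` the datum indicator and the forcing vanish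
    intro i n t hn
    have hq : ∀ s, quadTerm ε₀ α Y i n s = 0 := fun s => quadTerm_eq_zero_of_lt α hlow i hn s
    have hne : ¬(i = i₀ ∧ n = n₀) := fun h => by obtain ⟨_, h2⟩ := h; omega
    simp [hq, hne]
  · -- (B1): the critical envelope
    intro i n t ht
    have hdat : Real.exp (-(4 * Real.pi ^ 2 * (1 + ε₀) ^ (2 * n) * t)) *
        (if i = i₀ ∧ n = n₀ then |A| else 0) ≤ K * (1 + ε₀) ^ (-(n : ℝ) / 2) := by
      split_ifs with h
      · rw [h.2]
        refine (mul_le_of_le_one_left (abs_nonneg A) ?_).trans hA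
        rw [Real.exp_le_one_iff, neg_nonpos]
        have ht0 : 0 ≤ t := ht.1
        positivity
      · rw [mul_zero]
        positivity
    have hint := pumpMajorant_integral_quadTerm_le hε₀.le α Y zero_le_one le_rfl ht.1 i n
      (fun s hs j n' _ => by
        rw [mul_one]
        exact henv j n' s ⟨hs.1, hs.2.trans_lt ht.2⟩)
    rw [← hC, mul_one] at hint
    calc _ ≤ K * (1 + ε₀) ^ (-(n : ℝ) / 2) + C * K ^ 2 / (4 * Real.pi ^ 2) * (1 + ε₀) ^ (-(n : ℝ) / 2) :=
          add_le_add hdat hint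
      _ = (K + C * K ^ 2 / (4 * Real.pi ^ 2)) * (1 + ε₀) ^ (-(n : ℝ) / 2) := by ring
  · -- (B2): the geometric tail above the front
    intro k t ht htS i n hn
    have hne : ¬(i = i₀ ∧ n = n₀) := fun h => by obtain ⟨_, h2⟩ := h; omega
    rw [if_neg hne, mul_zero, zero_add]
    have hL0 : 0 ≤ (2 * (1 + ε₀)) ^ (n₀ + k + 2 - n) := zpow_nonneg (by linarith) _
    have hL1 : (2 * (1 + ε₀)) ^ (n₀ + k + 2 - n) ≤ 1 := zpow_le_one_of_nonpos₀ h2a (by omega)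
    have hint := pumpMajorant_integral_quadTerm_le hε₀.le α Y hL0 hL1 ht.1 i n
      (fun s hs j n' hn' => by
        refine (htail k s ⟨hs.1, hs.2.trans_lt ht.2⟩ (hs.2.trans_lt htS) j n' (by omega)).trans ?_
        exact mul_le_mul_of_nonneg_left (zpow_le_zpow_right₀ h2a (by omega)) (by positivity))
    rw [← hC] at hint
    refine hint.trans (mul_le_mul_of_nonneg_right (mul_le_mul_of_nonneg_right ?_ (by positivity)) hL0)
    linarith

end Summit.NavierStokesRegularity.NavierStokesRegularity.Theorems.PerpetualPumpPumpTransfer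

end
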